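import Literature.Topology.FourManifolds.CappellShanesonClassGroupFifteen
import Literature.Topology.FourManifolds.CappellShanesonIdealCertificates
import HarnessLib

/-!
# The class group of the trace `21` field (discriminant `114889`, prime) and Gompf's conjecture
# for the traces `21` and `-16` (Kim–Yamada 2023, Theorem B; Remark 1.2)

Serves the named fact
`Literature.Topology.FourManifolds.kimYamada2023_nonempty_diffeomorph_sphere_four_of_trace_mem_Icc`
(`CappellShaneson.lean`; M. H. Kim, S. Yamada, Kyungpook Math. J. 63 (2023) 373–411 =
arXiv:1707.03860, Cor. C), reduced in the tree to Gompf's topological leaves and Theorem B in matrix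
form (`GompfConjectureForTrace n`) for the traces not yet proved. This file PROVES Theorem B for the
trace `21` — the example of Kim–Yamada's Remark 1.2: "when `n = 21`, there are three corresponding
tuples `(1,1,21)`, `(5,7,21)` and `(9,13,21)` in Table 2. This means that every matrix `A` with
`tr(A) = 21` is similar to exactly one of … `X_{1,1,21}`, `X_{5,7,21}`, `X_{9,13,21}`" (here: to at
least one of them, `isConj_standardCSMatrix_of_trace_eq_twentyone`) — the two non-trivial classes
moving by Gompf moves to the traces `7 = 21 - 2·7` and `8 = 21 - 13` (Lemma 6.1 / §6.1), where Gompf's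
conjecture holds (class number one); and, by Theorem A, for `-16 = 5 - 21`.

## The number theory

For a cubic number field `K` generated by a root `θ` of `f₂₁ = x³ - 21x² + 20x - 1`:

* `Δ(f₂₁) = 114889` is prime, so `𝓞 K = ℤ[θ]`, `d_K = 114889`, `⌊M_K⌋ ≤ 95`;
* Dedekind–Kummer at `p ≤ 95` (Marcus, Ch. 3, Thm. 27): `2, 3, 5, 11, 23, 29, 47, 59, 79, 83` are
  inert; `f₂₁ ≡ (x - 5)(x² + 5x + 3) (mod 7)`; `37, 43, 53, 89` split (`(x-2)(x-23)(x-33)`,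
  `(x-5)(x-17)(x-42)`, `(x-10)(x-31)(x-33)`, `(x-57)(x-60)(x-82)`); unique roots `9, 10, 17, 16, 23,
  9, 50, 22, 43` modulo `13, 17, 19, 31, 41, 61, 67, 71, 73`;
* relations with explicit cofactors: `𝔭₇² = (49, θ - 19)` and `𝔭₇ (49, θ - 19) = (θ - 19)` (norm
  `343`), so `[𝔭₇]³ = 1`; `𝔭₇ 𝔮₄₉ = (7)`, `𝔭₇ 𝔭₁₃ = (3θ - 1)` (`91`), `𝔭₇ 𝔭₁₇ = (2θ - 3)` (`119`),
  `𝔭₇ 𝔭₁₉ = (θ + 2)` (`133`), `𝔭₃₁ = (2θ - 1)`, `(37, θ - 2) = (θ - 2)`, `𝔭₇ (37, θ - 23) = (5θ - 4)`,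
  `𝔭₁₃ (37, θ - 33) = (θ + 4)`, `𝔭₁₃ 𝔭₄₁ = (2θ - 5)`, `𝔭₇ (43, θ - 5) = (θ - 5)`, `𝔭₁₇ (43, θ - 17) =
  (5θ + 1)`, `(43, θ - 42) = (θ + 1)`, `𝔭₁₇ (53, θ - 10) = (θ - 10)`, `𝔭₁₃ (53, θ - 31) = (θ² - 2θ + 2)`,
  `𝔭₁₃ (53, θ - 33) = (5θ - 6)`, `𝔭₁₃ 𝔭₆₁ = (θ - 9)`, `𝔭₇ 𝔭₆₇ = (4θ + 1)`, `𝔭₁₃ 𝔭₇₁ = (2θ² - 2θ - 1)`,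
  `𝔭₇ 𝔭₇₃ = (θ² - 4θ + 2)`, `𝔭₇ (89, θ - 57) = (2θ² - 1)`, `(89, θ - 60) = (3θ - 2)`,
  `𝔭₁₃ (89, θ - 82) = (2θ² + θ - 2)`;
* hence every ideal class is `1`, `[𝔭₇]` or `[𝔭₁₃] = [𝔭₇]⁻¹` (`classGroup_mem_triple_twentyone`).

Transport to `ℤ[X]/(f₂₁)` and Prop. 2.14 (`exists_isConj_standardCSMatrix_of_cover`):
`gompfConjectureForTrace_twentyone`, `gompfConjectureForTrace_neg_sixteen`. No named fact is
introduced (D-0026).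

## References

* [KimYamada2023] M. H. Kim, S. Yamada, Kyungpook Math. J. 63 (2023) 373–411 (arXiv:1707.03860):
  Remark 1.2, §2.3 (Prop. 2.14), §5 (Table 2), §6.1 (Lemma 6.1 and the proof of Thm. B), Thm. A.
* [Marcus2018] D. A. Marcus, *Number Fields*, 2nd ed., Ch. 3, Thm. 27 (Dedekind–Kummer); Ch. 5,
  Cor. 2 of Thm. 37 (Minkowski bound).
-/

noncomputable section

open Set Polynomial Module NumberField Ideal
open scoped NumberField MatrixGroups nonZeroDivisors
open Literature.LinearAlgebra.Matrix

namespace Literature.Topology.FourManifolds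


section Field

variable {K : Type*} [Field K] [NumberField K] {θ : K}

/-! ### Discriminant `114889` and `𝓞 K = ℤ[θ]` -/

/-- `Δ(f₂₁) = 21·19·18·16 - 23 = 114889`. [cite: KimYamada2023, §3 (Δ(fₙ) = n(n-2)(n-3)(n-5) - 23)] -/
theorem csDisc_twentyone : csDisc 21 = 114889 := by
  decide

set_option maxRecDepth 8192 in
/-- `114889 = 114889` is squarefree, so `Δ(f₂₁)` has no factorisation `r² e` with `|e| > 2`,
`r ≠ ±1`, and `𝓞 K = ℤ[θ]`. [folklore] -/
theorem csDisc_twentyone_sq : ∀ r e : ℤ, csDisc 21 = r ^ 2 * e → 2 < |e| → IsUnit r :=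
  isUnit_of_eq_sq_mul (B := 338) (by decide) (by decide) (by decide)

/-- `d_K = 114889` for the trace `21` field. [folklore] -/
theorem discr_eq_twentyone (hθ : aeval θ (csPoly 21) = 0) (h3 : finrank ℚ K = 3) :
    NumberField.discr K = 114889 := by
  rw [discr_eq_csDisc_of_sq hθ h3 csDisc_twentyone_sq, csDisc_twentyone]

/-- The cubic relation `θ³ - 21θ² + 20θ - 1 = 0` in `𝓞 K`. [folklore] -/
theorem thetaInt_rel_twentyone (hθ : aeval θ (csPoly 21) = 0) :
    (thetaInt hθ) ^ 3 - 21 * (thetaInt hθ) ^ 2 + 20 * thetaInt hθ - 1 = 0 := by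
  have rel := thetaInt_rel hθ
  push_cast at rel
  linear_combination rel

/-! ### The primes of norm at most `95` (Dedekind–Kummer) -/

set_option maxRecDepth 16384 in
/-- The inert primes `2, 3, 5, 11, 23, 29, 47, 59, 79, 83` (no root of `f₂₁`): every prime above them is `(p)`. [folklore] -/
theorem eq_span_of_inert_twentyone (hθ : aeval θ (csPoly 21) = 0) (h3 : finrank ℚ K = 3) {p : ℕ}
    (hp : p = 2 ∨ p = 3 ∨ p = 5 ∨ p = 11 ∨ p = 23 ∨ p = 29 ∨ p = 47 ∨ p = 59 ∨ p = 79 ∨ p = 83)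
    {P : Ideal (𝓞 K)} (hP : P ∈ primesOver (span {(p : ℤ)}) (𝓞 K)) : P = span {(p : 𝓞 K)} := by
  rcases hp with rfl | rfl | rfl | rfl | rfl | rfl | rfl | rfl | rfl | rfl
  · exact eq_span_of_no_root_of_sq hθ h3 csDisc_twentyone_sq (by norm_num) hP (by decide)
  · exact eq_span_of_no_root_of_sq hθ h3 csDisc_twentyone_sq (by norm_num) hP (by decide)
  · exact eq_span_of_no_root_of_sq hθ h3 csDisc_twentyone_sq (by norm_num) hP (by decide)
  · exact eq_span_of_no_root_of_sq hθ h3 csDisc_twentyone_sq (by norm_num) hP (by decide)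
  · exact eq_span_of_no_root_of_sq hθ h3 csDisc_twentyone_sq (by norm_num) hP (by decide)
  · exact eq_span_of_no_root_of_sq hθ h3 csDisc_twentyone_sq (by norm_num) hP (by decide)
  · exact eq_span_of_no_root_of_sq hθ h3 csDisc_twentyone_sq (by norm_num) hP (by decide)
  · exact eq_span_of_no_root_of_sq hθ h3 csDisc_twentyone_sq (by norm_num) hP (by decide)
  · exact eq_span_of_no_root_of_sq hθ h3 csDisc_twentyone_sq (by norm_num) hP (by decide)
  · exact eq_span_of_no_root_of_sq hθ h3 csDisc_twentyone_sq (by norm_num) hP (by decide)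

set_option maxRecDepth 16384 in
/-- The degree-one primes at primes with a unique root of `f₂₁`: `(13, θ - 9)`, `(17, θ - 10)`, `(19, θ - 17)`, `(31, θ - 16)`, `(41, θ - 23)`, `(61, θ - 9)`, `(67, θ - 50)`, `(71, θ - 22)`, `(73, θ - 43)` are the only
primes `P` above them with `p ^ {f_P} ≤ 95`. [folklore] -/
theorem eq_span_pair_of_unique_root_twentyone (hθ : aeval θ (csPoly 21) = 0) (h3 : finrank ℚ K = 3)
    {p : ℕ} {c₀ : ℤ}
    (hp : (p = 13 ∧ c₀ = 9) ∨ (p = 17 ∧ c₀ = 10) ∨ (p = 19 ∧ c₀ = 17) ∨ (p = 31 ∧ c₀ = 16) ∨ (p = 41 ∧ c₀ = 23) ∨ (p = 61 ∧ c₀ = 9) ∨ (p = 67 ∧ c₀ = 50) ∨ (p = 71 ∧ c₀ = 22) ∨ (p = 73 ∧ c₀ = 43))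
    {P : Ideal (𝓞 K)} (hP : P ∈ primesOver (span {(p : ℤ)}) (𝓞 K)) (hle : p ^ P.inertiaDeg ℤ ≤ 95) :
    P = span {(p : 𝓞 K), thetaInt hθ - (c₀ : 𝓞 K)} := by
  rcases hp with ⟨rfl, rfl⟩ | ⟨rfl, rfl⟩ | ⟨rfl, rfl⟩ | ⟨rfl, rfl⟩ | ⟨rfl, rfl⟩ | ⟨rfl, rfl⟩ | ⟨rfl, rfl⟩ | ⟨rfl, rfl⟩ | ⟨rfl, rfl⟩
  · exact eq_span_pair_of_unique_root_of_sq hθ h3 csDisc_twentyone_sq (by norm_num) hP hle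
      (by decide) (by norm_num)
  · exact eq_span_pair_of_unique_root_of_sq hθ h3 csDisc_twentyone_sq (by norm_num) hP hle
      (by decide) (by norm_num)
  · exact eq_span_pair_of_unique_root_of_sq hθ h3 csDisc_twentyone_sq (by norm_num) hP hle
      (by decide) (by norm_num)
  · exact eq_span_pair_of_unique_root_of_sq hθ h3 csDisc_twentyone_sq (by norm_num) hP hle
      (by decide) (by norm_num)
  · exact eq_span_pair_of_unique_root_of_sq hθ h3 csDisc_twentyone_sq (by norm_num) hP hle
      (by decide) (by norm_num)
  · exact eq_span_pair_of_unique_root_of_sq hθ h3 csDisc_twentyone_sq (by norm_num) hP hle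
      (by decide) (by norm_num)
  · exact eq_span_pair_of_unique_root_of_sq hθ h3 csDisc_twentyone_sq (by norm_num) hP hle
      (by decide) (by norm_num)
  · exact eq_span_pair_of_unique_root_of_sq hθ h3 csDisc_twentyone_sq (by norm_num) hP hle
      (by decide) (by norm_num)
  · exact eq_span_pair_of_unique_root_of_sq hθ h3 csDisc_twentyone_sq (by norm_num) hP hle
      (by decide) (by norm_num)

/-- `f₂₁ = (x - 5)(x^2 + 5 * x + 3) + 7(-3 * x^2 + 6 * x + 2)`: the factorisation modulo `7`. [folklore] -/
theorem csPoly_twentyone_eq_seven :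
    csPoly 21 = (X - 5) * (X ^ 2 + 5 * X + 3) + 7 * (-3 * X ^ 2 + 6 * X + 2) := by
  simp only [csPoly, map_sub, map_one, map_ofNat]
  ring

set_option linter.unusedSimpArgs false in
/-- The lift `X ^ 2 + 5 * X + 3` reduces modulo `7` to the same expression in `𝔽₇[x]`. [folklore] -/
theorem map_quad_twentyone_seven :
    (X ^ 2 + 5 * X + 3 : ℤ[X]).map (Int.castRingHom (ZMod 7)) = X ^ 2 + 5 * X + 3 := by
  simp only [Polynomial.map_add, Polynomial.map_sub, Polynomial.map_neg, Polynomial.map_mul, Polynomial.map_pow,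
    map_X, Polynomial.map_ofNat, Polynomial.map_one]

set_option linter.unusedSimpArgs false in
/-- `f₂₁ mod 7 = (x - 5)·(X ^ 2 + 5 * X + 3)`. [folklore] -/
theorem csPolyMod_twentyone_seven :
    csPolyMod 21 7 = (X - C ((5 : ℤ) : ZMod 7)) *
      (X ^ 2 + 5 * X + 3 : ℤ[X]).map (Int.castRingHom (ZMod 7)) := by
  rw [csPolyMod, csPoly_twentyone_eq_seven, Polynomial.map_add]
  have hp : Polynomial.map (Int.castRingHom (ZMod 7)) (7 * (-3 * X ^ 2 + 6 * X + 2) : ℤ[X]) = 0 := by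
    rw [Polynomial.map_mul, show (7 : ℤ[X]) = C 7 from rfl, Polynomial.map_C]
    have : (Int.castRingHom (ZMod 7)) 7 = 0 := by decide
    rw [this, C_0, zero_mul]
  rw [hp, add_zero, map_quad_twentyone_seven]
  simp only [Polynomial.map_mul, Polynomial.map_sub, Polynomial.map_add, Polynomial.map_neg, Polynomial.map_pow,
    map_X, Polynomial.map_ofNat, Polynomial.map_one, Int.cast_ofNat, map_ofNat]

/-- `X ^ 2 + 5 * X + 3` is monic over `𝔽₇`. [folklore] -/
theorem monic_quad_twentyone_seven :
    ((X ^ 2 + 5 * X + 3 : ℤ[X]).map (Int.castRingHom (ZMod 7))).Monic := by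
  rw [map_quad_twentyone_seven]
  monicity!

/-- `X ^ 2 + 5 * X + 3` has no root modulo `7`. [folklore] -/
theorem quad_twentyone_seven_ne_zero : ∀ c : ZMod 7, c ^ 2 + 5 * c + 3 ≠ 0 := by
  decide

/-- `X ^ 2 + 5 * X + 3` is irreducible over `𝔽₇`. [folklore] -/
theorem irreducible_quad_twentyone_seven :
    Irreducible ((X ^ 2 + 5 * X + 3 : ℤ[X]).map (Int.castRingHom (ZMod 7))) := by
  haveI := Fact.mk (show Nat.Prime 7 by norm_num)
  rw [map_quad_twentyone_seven]
  have hdeg : (X ^ 2 + 5 * X + 3 : (ZMod 7)[X]).natDegree = 2 := by compute_degree!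
  refine irreducible_of_degree_le_three_of_not_isRoot (by rw [hdeg]; decide) fun c hc =>
    quad_twentyone_seven_ne_zero c ?_
  have h := hc
  rw [IsRoot.def] at h
  simpa using h

set_option linter.unusedSimpArgs false in
/-- **The primes above `7`**: `(7, θ - 5)` (degree one) and `(7, θ ^ 2 + 5 * θ + 3)` (degree two). [folklore] -/
theorem eq_P7_or_eq_Q7_twentyone (hθ : aeval θ (csPoly 21) = 0) (h3 : finrank ℚ K = 3)
    {P : Ideal (𝓞 K)} (hP : P ∈ primesOver (span {((7 : ℕ) : ℤ)}) (𝓞 K)) :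
    P = span {(7 : 𝓞 K), thetaInt hθ - 5} ∨
      P = span {(7 : 𝓞 K), thetaInt hθ ^ 2 + 5 * thetaInt hθ + 3} := by
  rcases eq_span_pair_of_linear_mul_quadratic_of_sq hθ h3 csDisc_twentyone_sq (by norm_num)
    monic_quad_twentyone_seven irreducible_quad_twentyone_seven csPolyMod_twentyone_seven hP with h | h
  · left; simpa using h
  · right
    simp only [map_add, map_sub, map_neg, map_mul, map_pow, aeval_X, map_ofNat, map_one] at h
    simpa using h

/-- `f₂₁ = (x - 2)(x - 23)(x - 33) + 37(x^2 - 23 * x + 41)`: `f₂₁ ≡ (x - 2)(x - 23)(x - 33) (mod 37)`. [folklore] -/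
theorem csPoly_twentyone_eq_thirtyseven :
    csPoly 21 = (X - 2) * (X - 23) * (X - 33) + 37 * (X ^ 2 - 23 * X + 41) := by
  simp only [csPoly, map_sub, map_one, map_ofNat]
  ring

/-- `f₂₁ mod 37 = (x - 2)(x - 23)(x - 33)`. [folklore] -/
theorem csPolyMod_twentyone_thirtyseven :
    csPolyMod 21 37 = (X - C ((2 : ℤ) : ZMod 37)) * (X - C ((23 : ℤ) : ZMod 37)) *
      (X - C ((33 : ℤ) : ZMod 37)) := by
  rw [csPolyMod, csPoly_twentyone_eq_thirtyseven, Polynomial.map_add]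
  have hp : Polynomial.map (Int.castRingHom (ZMod 37)) (37 * (X ^ 2 - 23 * X + 41) : ℤ[X]) = 0 := by
    rw [Polynomial.map_mul, show (37 : ℤ[X]) = C 37 from rfl, Polynomial.map_C]
    have : (Int.castRingHom (ZMod 37)) 37 = 0 := by decide
    rw [this, C_0, zero_mul]
  rw [hp, add_zero]
  simp only [Polynomial.map_mul, Polynomial.map_sub, map_X, Polynomial.map_ofNat, Int.cast_ofNat,
    map_ofNat]

/-- **The primes above `37`**: `(37, θ - 2)`, `(37, θ - 23)`, `(37, θ - 33)`. [folklore] -/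
theorem eq_P37_twentyone (hθ : aeval θ (csPoly 21) = 0) (h3 : finrank ℚ K = 3)
    {P : Ideal (𝓞 K)} (hP : P ∈ primesOver (span {((37 : ℕ) : ℤ)}) (𝓞 K)) :
    P = span {(37 : 𝓞 K), thetaInt hθ - 2} ∨ P = span {(37 : 𝓞 K), thetaInt hθ - 23} ∨
      P = span {(37 : 𝓞 K), thetaInt hθ - 33} := by
  rcases eq_span_pair_of_split_of_sq hθ h3 csDisc_twentyone_sq (by norm_num)
    csPolyMod_twentyone_thirtyseven hP with h | h | h
  · left; simpa using h
  · right; left; simpa using h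
  · right; right; simpa using h

/-- `f₂₁ = (x - 5)(x - 17)(x - 42) + 43(x^2 - 23 * x + 83)`: `f₂₁ ≡ (x - 5)(x - 17)(x - 42) (mod 43)`. [folklore] -/
theorem csPoly_twentyone_eq_fortythree :
    csPoly 21 = (X - 5) * (X - 17) * (X - 42) + 43 * (X ^ 2 - 23 * X + 83) := by
  simp only [csPoly, map_sub, map_one, map_ofNat]
  ring

/-- `f₂₁ mod 43 = (x - 5)(x - 17)(x - 42)`. [folklore] -/
theorem csPolyMod_twentyone_fortythree :
    csPolyMod 21 43 = (X - C ((5 : ℤ) : ZMod 43)) * (X - C ((17 : ℤ) : ZMod 43)) *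
      (X - C ((42 : ℤ) : ZMod 43)) := by
  rw [csPolyMod, csPoly_twentyone_eq_fortythree, Polynomial.map_add]
  have hp : Polynomial.map (Int.castRingHom (ZMod 43)) (43 * (X ^ 2 - 23 * X + 83) : ℤ[X]) = 0 := by
    rw [Polynomial.map_mul, show (43 : ℤ[X]) = C 43 from rfl, Polynomial.map_C]
    have : (Int.castRingHom (ZMod 43)) 43 = 0 := by decide
    rw [this, C_0, zero_mul]
  rw [hp, add_zero]
  simp only [Polynomial.map_mul, Polynomial.map_sub, map_X, Polynomial.map_ofNat, Int.cast_ofNat,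
    map_ofNat]

/-- **The primes above `43`**: `(43, θ - 5)`, `(43, θ - 17)`, `(43, θ - 42)`. [folklore] -/
theorem eq_P43_twentyone (hθ : aeval θ (csPoly 21) = 0) (h3 : finrank ℚ K = 3)
    {P : Ideal (𝓞 K)} (hP : P ∈ primesOver (span {((43 : ℕ) : ℤ)}) (𝓞 K)) :
    P = span {(43 : 𝓞 K), thetaInt hθ - 5} ∨ P = span {(43 : 𝓞 K), thetaInt hθ - 17} ∨
      P = span {(43 : 𝓞 K), thetaInt hθ - 42} := by
  rcases eq_span_pair_of_split_of_sq hθ h3 csDisc_twentyone_sq (by norm_num)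
    csPolyMod_twentyone_fortythree hP with h | h | h
  · left; simpa using h
  · right; left; simpa using h
  · right; right; simpa using h

/-- `f₂₁ = (x - 10)(x - 31)(x - 33) + 53(x^2 - 31 * x + 193)`: `f₂₁ ≡ (x - 10)(x - 31)(x - 33) (mod 53)`. [folklore] -/
theorem csPoly_twentyone_eq_fiftythree :
    csPoly 21 = (X - 10) * (X - 31) * (X - 33) + 53 * (X ^ 2 - 31 * X + 193) := by
  simp only [csPoly, map_sub, map_one, map_ofNat]
  ring

/-- `f₂₁ mod 53 = (x - 10)(x - 31)(x - 33)`. [folklore] -/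
theorem csPolyMod_twentyone_fiftythree :
    csPolyMod 21 53 = (X - C ((10 : ℤ) : ZMod 53)) * (X - C ((31 : ℤ) : ZMod 53)) *
      (X - C ((33 : ℤ) : ZMod 53)) := by
  rw [csPolyMod, csPoly_twentyone_eq_fiftythree, Polynomial.map_add]
  have hp : Polynomial.map (Int.castRingHom (ZMod 53)) (53 * (X ^ 2 - 31 * X + 193) : ℤ[X]) = 0 := by
    rw [Polynomial.map_mul, show (53 : ℤ[X]) = C 53 from rfl, Polynomial.map_C]
    have : (Int.castRingHom (ZMod 53)) 53 = 0 := by decide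
    rw [this, C_0, zero_mul]
  rw [hp, add_zero]
  simp only [Polynomial.map_mul, Polynomial.map_sub, map_X, Polynomial.map_ofNat, Int.cast_ofNat,
    map_ofNat]

/-- **The primes above `53`**: `(53, θ - 10)`, `(53, θ - 31)`, `(53, θ - 33)`. [folklore] -/
theorem eq_P53_twentyone (hθ : aeval θ (csPoly 21) = 0) (h3 : finrank ℚ K = 3)
    {P : Ideal (𝓞 K)} (hP : P ∈ primesOver (span {((53 : ℕ) : ℤ)}) (𝓞 K)) :
    P = span {(53 : 𝓞 K), thetaInt hθ - 10} ∨ P = span {(53 : 𝓞 K), thetaInt hθ - 31} ∨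
      P = span {(53 : 𝓞 K), thetaInt hθ - 33} := by
  rcases eq_span_pair_of_split_of_sq hθ h3 csDisc_twentyone_sq (by norm_num)
    csPolyMod_twentyone_fiftythree hP with h | h | h
  · left; simpa using h
  · right; left; simpa using h
  · right; right; simpa using h

/-- `f₂₁ = (x - 57)(x - 60)(x - 82) + 89(2 * x^2 - 146 * x + 3151)`: `f₂₁ ≡ (x - 57)(x - 60)(x - 82) (mod 89)`. [folklore] -/
theorem csPoly_twentyone_eq_eightynine :
    csPoly 21 = (X - 57) * (X - 60) * (X - 82) + 89 * (2 * X ^ 2 - 146 * X + 3151) := by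
  simp only [csPoly, map_sub, map_one, map_ofNat]
  ring

/-- `f₂₁ mod 89 = (x - 57)(x - 60)(x - 82)`. [folklore] -/
theorem csPolyMod_twentyone_eightynine :
    csPolyMod 21 89 = (X - C ((57 : ℤ) : ZMod 89)) * (X - C ((60 : ℤ) : ZMod 89)) *
      (X - C ((82 : ℤ) : ZMod 89)) := by
  rw [csPolyMod, csPoly_twentyone_eq_eightynine, Polynomial.map_add]
  have hp : Polynomial.map (Int.castRingHom (ZMod 89)) (89 * (2 * X ^ 2 - 146 * X + 3151) : ℤ[X]) = 0 := by
    rw [Polynomial.map_mul, show (89 : ℤ[X]) = C 89 from rfl, Polynomial.map_C]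
    have : (Int.castRingHom (ZMod 89)) 89 = 0 := by decide
    rw [this, C_0, zero_mul]
  rw [hp, add_zero]
  simp only [Polynomial.map_mul, Polynomial.map_sub, map_X, Polynomial.map_ofNat, Int.cast_ofNat,
    map_ofNat]

/-- **The primes above `89`**: `(89, θ - 57)`, `(89, θ - 60)`, `(89, θ - 82)`. [folklore] -/
theorem eq_P89_twentyone (hθ : aeval θ (csPoly 21) = 0) (h3 : finrank ℚ K = 3)
    {P : Ideal (𝓞 K)} (hP : P ∈ primesOver (span {((89 : ℕ) : ℤ)}) (𝓞 K)) :
    P = span {(89 : 𝓞 K), thetaInt hθ - 57} ∨ P = span {(89 : 𝓞 K), thetaInt hθ - 60} ∨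
      P = span {(89 : 𝓞 K), thetaInt hθ - 82} := by
  rcases eq_span_pair_of_split_of_sq hθ h3 csDisc_twentyone_sq (by norm_num)
    csPolyMod_twentyone_eightynine hP with h | h | h
  · left; simpa using h
  · right; left; simpa using h
  · right; right; simpa using h

/-! ### Relations among the small primes: explicit generators -/

/-- **`𝔭₇² = (49, θ - 19)`** (`19 ≡ 5 (mod 7)` is the root of `f₂₁` modulo `49`). [folklore] -/
theorem P7_mul_P7_twentyone (hθ : aeval θ (csPoly 21) = 0) :
    span {(7 : 𝓞 K), thetaInt hθ - 5} * span {(7 : 𝓞 K), thetaInt hθ - 5} =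
      span {(49 : 𝓞 K), thetaInt hθ - 19} := by
  have rel := thetaInt_rel_twentyone hθ
  set t := thetaInt hθ with ht
  exact span_pair_mul_span_pair_eq_span_pair
    (α₁ := 1) (β₁ := 0)
    (α₂ := 2) (β₂ := 7)
    (α₃ := 2) (β₃ := 7)
    (α₄ := -181 * t ^ 2) (β₄ := 9335 * t ^ 2 - 9800 * t + 490)
    (u₁ := 1) (u₂ := 0) (u₃ := 0) (u₄ := 0)
    (v₁ := -703 * t ^ 2) (v₂ := -384 * t) (v₃ := 0) (v₄ := 96 * t ^ 2 + 1325 * t - 96)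
    (by ring) (by ring) (by ring) (by linear_combination (-9335 : 𝓞 K) * rel)
    (by ring) (by linear_combination (-96 * t - 2381) * rel)

/-- **`𝔭₇ (49, θ - 19) = (θ - 19)`** (`N(θ - 19) = 343`): with `𝔭₇² = (49, θ - 19)`, `[𝔭₇]³ = 1`. [folklore] -/
theorem P7_mul_P49_twentyone (hθ : aeval θ (csPoly 21) = 0) :
    span {(7 : 𝓞 K), thetaInt hθ - 5} * span {(49 : 𝓞 K), thetaInt hθ - 19} =
      span {thetaInt hθ - 19} := by
  have rel := thetaInt_rel_twentyone hθ
  set t := thetaInt hθ with ht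
  exact span_pair_mul_span_pair_eq_span_singleton
    (δ₁ := t ^ 2 - 2 * t - 18) (δ₂ := 7)
    (δ₃ := 2 * t ^ 2 - 4 * t + 13) (δ₄ := t - 5)
    (u₁ := -1501 * t ^ 2) (u₂ := 293756 * t + 2852) (u₃ := 0) (u₄ := 1426 * t ^ 2 + 519045 * t - 1426)
    (by linear_combination (-1 : 𝓞 K) * rel) (by ring)
    (by linear_combination (-2 : 𝓞 K) * rel) (by ring)
    (by linear_combination (-1426 * t - 514767) * rel)

/-- **`𝔭₇ 𝔮₄₉ = (7)`**, `𝔮₄₉ = (7, θ² + 5θ + 3)` the prime of degree two above `7` (`f₂₁ ≡ (x - 5)(x² + 5x + 3) (mod 7)`). [folklore] -/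
theorem P7_mul_Q7_twentyone (hθ : aeval θ (csPoly 21) = 0) :
    span {(7 : 𝓞 K), thetaInt hθ - 5} * span {(7 : 𝓞 K), thetaInt hθ ^ 2 + 5 * thetaInt hθ + 3} =
      span {7} := by
  have rel := thetaInt_rel_twentyone hθ
  set t := thetaInt hθ with ht
  exact span_pair_mul_span_pair_eq_span_singleton
    (δ₁ := 7) (δ₂ := t ^ 2 + 5 * t + 3)
    (δ₃ := t - 5) (δ₄ := 3 * t ^ 2 - 6 * t - 2)
    (u₁ := 54516 * t ^ 2) (u₂ := 17 * t ^ 2 - 66197 * t) (u₃ := -54958 * t ^ 2 - 1947) (u₄ := 1947 * t ^ 2)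
    (by ring) (by ring)
    (by ring) (by linear_combination (1 : 𝓞 K) * rel)
    (by linear_combination (-1947 * t ^ 2 - 41006 * t + 68138) * rel)

/-- **`𝔭₇ 𝔭₁₃ = (3θ - 1)`** (`N = -91`). [folklore] -/
theorem P7_mul_P13_twentyone (hθ : aeval θ (csPoly 21) = 0) :
    span {(7 : 𝓞 K), thetaInt hθ - 5} * span {(13 : 𝓞 K), thetaInt hθ - 9} =
      span {3 * thetaInt hθ - 1} := by
  have rel := thetaInt_rel_twentyone hθ
  set t := thetaInt hθ with ht
  exact span_pair_mul_span_pair_eq_span_singleton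
    (δ₁ := -9 * t ^ 2 + 186 * t - 118) (δ₂ := 6 * t ^ 2 - 124 * t + 81)
    (δ₃ := 6 * t ^ 2 - 124 * t + 83) (δ₄ := -4 * t ^ 2 + 83 * t - 57)
    (u₁ := 2) (u₂ := 6) (u₃ := -3) (u₄ := 0)
    (by linear_combination (27 : 𝓞 K) * rel) (by linear_combination (-18 : 𝓞 K) * rel)
    (by linear_combination (-18 : 𝓞 K) * rel) (by linear_combination (12 : 𝓞 K) * rel)
    (by ring)

/-- **`𝔭₇ 𝔭₁₇ = (2θ - 3)`** (`N = 119`). [folklore] -/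
theorem P7_mul_P17_twentyone (hθ : aeval θ (csPoly 21) = 0) :
    span {(7 : 𝓞 K), thetaInt hθ - 5} * span {(17 : 𝓞 K), thetaInt hθ - 10} =
      span {2 * thetaInt hθ - 3} := by
  have rel := thetaInt_rel_twentyone hθ
  set t := thetaInt hθ with ht
  exact span_pair_mul_span_pair_eq_span_singleton
    (δ₁ := 4 * t ^ 2 - 78 * t - 37) (δ₂ := -2 * t ^ 2 + 39 * t + 22)
    (δ₃ := -2 * t ^ 2 + 39 * t + 27) (δ₄ := t ^ 2 - 19 * t - 16)
    (u₁ := -2) (u₂ := -7) (u₃ := 3) (u₄ := 0)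
    (by linear_combination (-8 : 𝓞 K) * rel) (by linear_combination (4 : 𝓞 K) * rel)
    (by linear_combination (4 : 𝓞 K) * rel) (by linear_combination (-2 : 𝓞 K) * rel)
    (by ring)

/-- **`𝔭₇ 𝔭₁₉ = (θ + 2)`** (`N = 133`). [folklore] -/
theorem P7_mul_P19_twentyone (hθ : aeval θ (csPoly 21) = 0) :
    span {(7 : 𝓞 K), thetaInt hθ - 5} * span {(19 : 𝓞 K), thetaInt hθ - 17} =
      span {thetaInt hθ + 2} := by
  have rel := thetaInt_rel_twentyone hθ
  set t := thetaInt hθ with ht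
  exact span_pair_mul_span_pair_eq_span_singleton
    (δ₁ := t ^ 2 - 23 * t + 66) (δ₂ := -t ^ 2 + 23 * t - 59)
    (δ₃ := -t ^ 2 + 23 * t - 47) (δ₄ := t ^ 2 - 22 * t + 42)
    (u₁ := -5) (u₂ := -8) (u₃ := 3) (u₄ := 0)
    (by linear_combination (-1 : 𝓞 K) * rel) (by linear_combination (1 : 𝓞 K) * rel)
    (by linear_combination (1 : 𝓞 K) * rel) (by linear_combination (-1 : 𝓞 K) * rel)
    (by ring)

/-- **`𝔭₃₁ = (31, θ - 16) = (2θ - 1)` is principal** (`N(2θ - 1) = -31`). [folklore] -/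
theorem P31_eq_twentyone (hθ : aeval θ (csPoly 21) = 0) :
    span {(31 : 𝓞 K), thetaInt hθ - 16} = span {2 * thetaInt hθ - 1} := by
  have rel := thetaInt_rel_twentyone hθ
  set t := thetaInt hθ with ht
  exact span_pair_eq_span_singleton (u := 1) (v := 2) (δ := -4 * t ^ 2 + 82 * t - 39)
    (ε := 2 * t ^ 2 - 41 * t + 20)
    (by ring) (by linear_combination (8 : 𝓞 K) * rel) (by linear_combination (-4 : 𝓞 K) * rel)

/-- **`(37, θ - 2) = (θ - 2)` is principal** (`N(θ - 2) = 37`). [folklore] -/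
theorem P37a_eq_twentyone (hθ : aeval θ (csPoly 21) = 0) :
    span {(37 : 𝓞 K), thetaInt hθ - 2} = span {thetaInt hθ - 2} := by
  have rel := thetaInt_rel_twentyone hθ
  set t := thetaInt hθ with ht
  exact span_pair_eq_span_singleton (u := 0) (v := 1) (δ := t ^ 2 - 19 * t - 18)
    (ε := 1)
    (by ring) (by linear_combination (-1 : 𝓞 K) * rel) (by ring)

/-- **`𝔭₇ (37, θ - 23) = (5θ - 4)`** (`N = -259`). [folklore] -/
theorem P7_mul_P37b_twentyone (hθ : aeval θ (csPoly 21) = 0) :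
    span {(7 : 𝓞 K), thetaInt hθ - 5} * span {(37 : 𝓞 K), thetaInt hθ - 23} =
      span {5 * thetaInt hθ - 4} := by
  have rel := thetaInt_rel_twentyone hθ
  set t := thetaInt hθ with ht
  exact span_pair_mul_span_pair_eq_span_singleton
    (δ₁ := -25 * t ^ 2 + 505 * t - 96) (δ₂ := 15 * t ^ 2 - 303 * t + 59)
    (δ₃ := 15 * t ^ 2 - 303 * t + 65) (δ₄ := -9 * t ^ 2 + 182 * t - 40)
    (u₁ := 3) (u₂ := 6) (u₃ := -1) (u₄ := 0)
    (by linear_combination (125 : 𝓞 K) * rel) (by linear_combination (-75 : 𝓞 K) * rel)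
    (by linear_combination (-75 : 𝓞 K) * rel) (by linear_combination (45 : 𝓞 K) * rel)
    (by ring)

/-- **`𝔭₁₃ (37, θ - 33) = (θ + 4)`** (`N = 481`). [folklore] -/
theorem P13_mul_P37c_twentyone (hθ : aeval θ (csPoly 21) = 0) :
    span {(13 : 𝓞 K), thetaInt hθ - 9} * span {(37 : 𝓞 K), thetaInt hθ - 33} =
      span {thetaInt hθ + 4} := by
  have rel := thetaInt_rel_twentyone hθ
  set t := thetaInt hθ with ht
  exact span_pair_mul_span_pair_eq_span_singleton
    (δ₁ := t ^ 2 - 25 * t + 120) (δ₂ := -t ^ 2 + 25 * t - 107)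
    (δ₃ := -t ^ 2 + 25 * t - 83) (δ₄ := t ^ 2 - 24 * t + 74)
    (u₁ := -11) (u₂ := -17) (u₃ := 6) (u₄ := 0)
    (by linear_combination (-1 : 𝓞 K) * rel) (by linear_combination (1 : 𝓞 K) * rel)
    (by linear_combination (1 : 𝓞 K) * rel) (by linear_combination (-1 : 𝓞 K) * rel)
    (by ring)

/-- **`𝔭₁₃ 𝔭₄₁ = (2θ - 5)`** (`N = 533`). [folklore] -/
theorem P13_mul_P41_twentyone (hθ : aeval θ (csPoly 21) = 0) :
    span {(13 : 𝓞 K), thetaInt hθ - 9} * span {(41 : 𝓞 K), thetaInt hθ - 23} =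
      span {2 * thetaInt hθ - 5} := by
  have rel := thetaInt_rel_twentyone hθ
  set t := thetaInt hθ with ht
  exact span_pair_mul_span_pair_eq_span_singleton
    (δ₁ := 4 * t ^ 2 - 74 * t - 105) (δ₂ := -2 * t ^ 2 + 37 * t + 59)
    (δ₃ := -2 * t ^ 2 + 37 * t + 73) (δ₄ := t ^ 2 - 18 * t - 41)
    (u₁ := -1) (u₂ := -3) (u₃ := 1) (u₄ := 0)
    (by linear_combination (-8 : 𝓞 K) * rel) (by linear_combination (4 : 𝓞 K) * rel)
    (by linear_combination (4 : 𝓞 K) * rel) (by linear_combination (-2 : 𝓞 K) * rel)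
    (by ring)

/-- **`𝔭₇ (43, θ - 5) = (θ - 5)`** (`N = 301`). [folklore] -/
theorem P7_mul_P43a_twentyone (hθ : aeval θ (csPoly 21) = 0) :
    span {(7 : 𝓞 K), thetaInt hθ - 5} * span {(43 : 𝓞 K), thetaInt hθ - 5} =
      span {thetaInt hθ - 5} := by
  have rel := thetaInt_rel_twentyone hθ
  set t := thetaInt hθ with ht
  exact span_pair_mul_span_pair_eq_span_singleton
    (δ₁ := t ^ 2 - 16 * t - 60) (δ₂ := 7)
    (δ₃ := 43) (δ₄ := t - 5)
    (u₁ := 0) (u₂ := -6) (u₃ := 1) (u₄ := 0)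
    (by linear_combination (-1 : 𝓞 K) * rel) (by ring)
    (by ring) (by ring)
    (by ring)

/-- **`𝔭₁₇ (43, θ - 17) = (5θ + 1)`** (`N = 731`). [folklore] -/
theorem P17_mul_P43b_twentyone (hθ : aeval θ (csPoly 21) = 0) :
    span {(17 : 𝓞 K), thetaInt hθ - 10} * span {(43 : 𝓞 K), thetaInt hθ - 17} =
      span {5 * thetaInt hθ + 1} := by
  have rel := thetaInt_rel_twentyone hθ
  set t := thetaInt hθ with ht
  exact span_pair_mul_span_pair_eq_span_singleton
    (δ₁ := 25 * t ^ 2 - 530 * t + 606) (δ₂ := -10 * t ^ 2 + 212 * t - 239)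
    (δ₃ := -15 * t ^ 2 + 318 * t - 355) (δ₄ := 6 * t ^ 2 - 127 * t + 140)
    (u₁ := 3) (u₂ := 18) (u₃ := -7) (u₄ := 0)
    (by linear_combination (-125 : 𝓞 K) * rel) (by linear_combination (50 : 𝓞 K) * rel)
    (by linear_combination (75 : 𝓞 K) * rel) (by linear_combination (-30 : 𝓞 K) * rel)
    (by ring)

/-- **`(43, θ - 42) = (θ + 1)` is principal** (`N(θ + 1) = 43`). [folklore] -/
theorem P43c_eq_twentyone (hθ : aeval θ (csPoly 21) = 0) :
    span {(43 : 𝓞 K), thetaInt hθ - 42} = span {thetaInt hθ + 1} := by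
  have rel := thetaInt_rel_twentyone hθ
  set t := thetaInt hθ with ht
  exact span_pair_eq_span_singleton (u := 1) (v := 1) (δ := t ^ 2 - 22 * t + 42)
    (ε := -t ^ 2 + 22 * t - 41)
    (by ring) (by linear_combination (-1 : 𝓞 K) * rel) (by linear_combination (1 : 𝓞 K) * rel)

/-- **`𝔭₁₇ (53, θ - 10) = (θ - 10)`** (`N = 901`). [folklore] -/
theorem P17_mul_P53a_twentyone (hθ : aeval θ (csPoly 21) = 0) :
    span {(17 : 𝓞 K), thetaInt hθ - 10} * span {(53 : 𝓞 K), thetaInt hθ - 10} =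
      span {thetaInt hθ - 10} := by
  have rel := thetaInt_rel_twentyone hθ
  set t := thetaInt hθ with ht
  exact span_pair_mul_span_pair_eq_span_singleton
    (δ₁ := t ^ 2 - 11 * t - 90) (δ₂ := 17)
    (δ₃ := 53) (δ₄ := t - 10)
    (u₁ := 0) (u₂ := 25) (u₃ := -8) (u₄ := 0)
    (by linear_combination (-1 : 𝓞 K) * rel) (by ring)
    (by ring) (by ring)
    (by ring)

/-- **`𝔭₁₃ (53, θ - 31) = (θ² - 2θ + 2)`** (`N = 689`). [folklore] -/
theorem P13_mul_P53b_twentyone (hθ : aeval θ (csPoly 21) = 0) :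
    span {(13 : 𝓞 K), thetaInt hθ - 9} * span {(53 : 𝓞 K), thetaInt hθ - 31} =
      span {thetaInt hθ ^ 2 - 2 * thetaInt hθ + 2} := by
  have rel := thetaInt_rel_twentyone hθ
  set t := thetaInt hθ with ht
  exact span_pair_mul_span_pair_eq_span_singleton
    (δ₁ := -20 * t ^ 2 + 383 * t + 343) (δ₂ := 11 * t ^ 2 - 210 * t - 201)
    (δ₃ := 11 * t ^ 2 - 208 * t - 239) (δ₄ := -6 * t ^ 2 + 113 * t + 140)
    (u₁ := 3) (u₂ := 7) (u₃ := -1) (u₄ := 1)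
    (by linear_combination (20 * t - 3) * rel) (by linear_combination (-11 * t + 1) * rel)
    (by linear_combination (-11 * t - 1) * rel) (by linear_combination (6 * t + 1) * rel)
    (by ring)

/-- **`𝔭₁₃ (53, θ - 33) = (5θ - 6)`** (`N = 689`). [folklore] -/
theorem P13_mul_P53c_twentyone (hθ : aeval θ (csPoly 21) = 0) :
    span {(13 : 𝓞 K), thetaInt hθ - 9} * span {(53 : 𝓞 K), thetaInt hθ - 33} =
      span {5 * thetaInt hθ - 6} := by
  have rel := thetaInt_rel_twentyone hθ
  set t := thetaInt hθ with ht
  exact span_pair_mul_span_pair_eq_span_singleton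
    (δ₁ := 25 * t ^ 2 - 495 * t - 94) (δ₂ := -15 * t ^ 2 + 297 * t + 59)
    (δ₃ := -15 * t ^ 2 + 297 * t + 67) (δ₄ := 9 * t ^ 2 - 178 * t - 42)
    (u₁ := -9) (u₂ := -20) (u₃ := 5) (u₄ := 0)
    (by linear_combination (-125 : 𝓞 K) * rel) (by linear_combination (75 : 𝓞 K) * rel)
    (by linear_combination (75 : 𝓞 K) * rel) (by linear_combination (-45 : 𝓞 K) * rel)
    (by ring)

/-- **`𝔭₁₃ 𝔭₆₁ = (θ - 9)`** (`N = 793`). [folklore] -/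
theorem P13_mul_P61_twentyone (hθ : aeval θ (csPoly 21) = 0) :
    span {(13 : 𝓞 K), thetaInt hθ - 9} * span {(61 : 𝓞 K), thetaInt hθ - 9} =
      span {thetaInt hθ - 9} := by
  have rel := thetaInt_rel_twentyone hθ
  set t := thetaInt hθ with ht
  exact span_pair_mul_span_pair_eq_span_singleton
    (δ₁ := t ^ 2 - 12 * t - 88) (δ₂ := 13)
    (δ₃ := 61) (δ₄ := t - 9)
    (u₁ := 0) (u₂ := -14) (u₃ := 3) (u₄ := 0)
    (by linear_combination (-1 : 𝓞 K) * rel) (by ring)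
    (by ring) (by ring)
    (by ring)

/-- **`𝔭₇ 𝔭₆₇ = (4θ + 1)`** (`N = 469`). [folklore] -/
theorem P7_mul_P67_twentyone (hθ : aeval θ (csPoly 21) = 0) :
    span {(7 : 𝓞 K), thetaInt hθ - 5} * span {(67 : 𝓞 K), thetaInt hθ - 50} =
      span {4 * thetaInt hθ + 1} := by
  have rel := thetaInt_rel_twentyone hθ
  set t := thetaInt hθ with ht
  exact span_pair_mul_span_pair_eq_span_singleton
    (δ₁ := 16 * t ^ 2 - 340 * t + 405) (δ₂ := -12 * t ^ 2 + 255 * t - 302)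
    (δ₃ := -12 * t ^ 2 + 255 * t - 287) (δ₄ := 9 * t ^ 2 - 191 * t + 214)
    (u₁ := -6) (u₂ := -9) (u₃ := 1) (u₄ := 0)
    (by linear_combination (-64 : 𝓞 K) * rel) (by linear_combination (48 : 𝓞 K) * rel)
    (by linear_combination (48 : 𝓞 K) * rel) (by linear_combination (-36 : 𝓞 K) * rel)
    (by ring)

/-- **`𝔭₁₃ 𝔭₇₁ = (2θ² - 2θ - 1)`** (`N = 923`). [folklore] -/
theorem P13_mul_P71_twentyone (hθ : aeval θ (csPoly 21) = 0) :
    span {(13 : 𝓞 K), thetaInt hθ - 9} * span {(71 : 𝓞 K), thetaInt hθ - 22} =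
      span {2 * thetaInt hθ ^ 2 - 2 * thetaInt hθ - 1} := by
  have rel := thetaInt_rel_twentyone hθ
  set t := thetaInt hθ with ht
  exact span_pair_mul_span_pair_eq_span_singleton
    (δ₁ := 2 * t ^ 2 + 2 * t - 839) (δ₂ := -13 * t + 260)
    (δ₃ := 2 * t ^ 2 - 69 * t + 581) (δ₄ := -t ^ 2 + 29 * t - 180)
    (u₁ := 4) (u₂ := 21) (u₃ := -3) (u₄ := 2)
    (by linear_combination (-4 * t - 84) * rel) (by linear_combination (26 : 𝓞 K) * rel)
    (by linear_combination (-4 * t + 58) * rel) (by linear_combination (2 * t - 18) * rel)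
    (by ring)

/-- **`𝔭₇ 𝔭₇₃ = (θ² - 4θ + 2)`** (`N = -511`). [folklore] -/
theorem P7_mul_P73_twentyone (hθ : aeval θ (csPoly 21) = 0) :
    span {(7 : 𝓞 K), thetaInt hθ - 5} * span {(73 : 𝓞 K), thetaInt hθ - 43} =
      span {thetaInt hθ ^ 2 - 4 * thetaInt hθ + 2} := by
  have rel := thetaInt_rel_twentyone hθ
  set t := thetaInt hθ with ht
  exact span_pair_mul_span_pair_eq_span_singleton
    (δ₁ := 50 * t ^ 2 - 1017 * t + 339) (δ₂ := -29 * t ^ 2 + 590 * t - 199)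
    (δ₃ := -31 * t ^ 2 + 632 * t - 235) (δ₄ := 18 * t ^ 2 - 367 * t + 138)
    (u₁ := -13) (u₂ := -25) (u₃ := 3) (u₄ := 1)
    (by linear_combination (-50 * t + 167) * rel) (by linear_combination (29 * t - 97) * rel)
    (by linear_combination (31 * t - 105) * rel) (by linear_combination (-18 * t + 61) * rel)
    (by ring)

/-- **`𝔭₇ (89, θ - 57) = (2θ² - 1)`** (`N = -623`). [folklore] -/
theorem P7_mul_P89a_twentyone (hθ : aeval θ (csPoly 21) = 0) :
    span {(7 : 𝓞 K), thetaInt hθ - 5} * span {(89 : 𝓞 K), thetaInt hθ - 57} =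
      span {2 * thetaInt hθ ^ 2 - 1} := by
  have rel := thetaInt_rel_twentyone hθ
  set t := thetaInt hθ with ht
  exact span_pair_mul_span_pair_eq_span_singleton
    (δ₁ := -82 * t ^ 2 + 1676 * t - 715) (δ₂ := 52 * t ^ 2 - 1063 * t + 457)
    (δ₃ := 52 * t ^ 2 - 1065 * t + 499) (δ₄ := -33 * t ^ 2 + 676 * t - 319)
    (u₁ := 3) (u₂ := 5) (u₃ := 1) (u₄ := 2)
    (by linear_combination (164 * t + 92) * rel) (by linear_combination (-104 * t - 58) * rel)
    (by linear_combination (-104 * t - 54) * rel) (by linear_combination (66 * t + 34) * rel)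
    (by ring)

/-- **`(89, θ - 60) = (3θ - 2)` is principal** (`N(3θ - 2) = -89`). [folklore] -/
theorem P89b_eq_twentyone (hθ : aeval θ (csPoly 21) = 0) :
    span {(89 : 𝓞 K), thetaInt hθ - 60} = span {3 * thetaInt hθ - 2} := by
  have rel := thetaInt_rel_twentyone hθ
  set t := thetaInt hθ with ht
  exact span_pair_eq_span_singleton (u := 2) (v := 3) (δ := -9 * t ^ 2 + 183 * t - 58)
    (ε := 6 * t ^ 2 - 122 * t + 39)
    (by ring) (by linear_combination (27 : 𝓞 K) * rel) (by linear_combination (-18 : 𝓞 K) * rel)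

/-- **`𝔭₁₃ (89, θ - 82) = (2θ² + θ - 2)`** (`N = -1157`). [folklore] -/
theorem P13_mul_P89c_twentyone (hθ : aeval θ (csPoly 21) = 0) :
    span {(13 : 𝓞 K), thetaInt hθ - 9} * span {(89 : 𝓞 K), thetaInt hθ - 82} =
      span {2 * thetaInt hθ ^ 2 + thetaInt hθ - 2} := by
  have rel := thetaInt_rel_twentyone hθ
  set t := thetaInt hθ with ht
  exact span_pair_mul_span_pair_eq_span_singleton
    (δ₁ := -127 * t ^ 2 + 2577 * t - 732) (δ₂ := 116 * t ^ 2 - 2354 * t + 673)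
    (δ₃ := 81 * t ^ 2 - 1645 * t + 497) (δ₄ := -74 * t ^ 2 + 1503 * t - 457)
    (u₁ := -22) (u₂ := -27) (u₃ := 6) (u₄ := 2)
    (by linear_combination (254 * t + 307) * rel) (by linear_combination (-232 * t - 280) * rel)
    (by linear_combination (-162 * t - 193) * rel) (by linear_combination (148 * t + 176) * rel)
    (by ring)


/-! ### Every ideal class is `1`, `[𝔭₇]` or `[𝔭₁₃] = [𝔭₇]²` -/

/-- `𝔭₇ = (7, θ - 5)` is a nonzero ideal. [folklore] -/
theorem P7_mem_nonZeroDivisors_twentyone (hθ : aeval θ (csPoly 21) = 0) :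
    span {(7 : 𝓞 K), thetaInt hθ - 5} ∈ (Ideal (𝓞 K))⁰ := by
  have h := span_pair_natCast_mem_nonZeroDivisors (K := K) (n := 7) (Nat.succ_ne_zero 6)
    (thetaInt hθ - 5)
  simp only [Nat.cast_ofNat] at h
  exact h

/-- `𝔭₁₃ = (13, θ - 9)` is a nonzero ideal. [folklore] -/
theorem P13_mem_nonZeroDivisors_twentyone (hθ : aeval θ (csPoly 21) = 0) :
    span {(13 : 𝓞 K), thetaInt hθ - 9} ∈ (Ideal (𝓞 K))⁰ := by
  have h := span_pair_natCast_mem_nonZeroDivisors (K := K) (n := 13) (by norm_num)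
    (thetaInt hθ - 9)
  simp only [Nat.cast_ofNat] at h
  exact h

/-- **Every ideal class of the trace `21` field is `1`, `[𝔭₇]` or `[𝔭₁₃]`, with `[𝔭₇]³ = 1` and
`[𝔭₁₃] = [𝔭₇]⁻¹`** (class number `≤ 3`; Kim–Yamada, Remark 1.2: "every matrix `A` with `tr(A) = 21` is
similar to exactly one of `X_{1,1,21}, X_{5,7,21}, X_{9,13,21}`"). Proof: `d_K = 114889`, `⌊M_K⌋ ≤ 95`;
Dedekind–Kummer at `p ≤ 95` and the relations listed in the module docstring. [cite: KimYamada2023, §6.1 (proof of Thm. B)] -/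
theorem classGroup_mem_triple_twentyone (hθ : aeval θ (csPoly 21) = 0) (h3 : finrank ℚ K = 3)
    (C : ClassGroup (𝓞 K)) :
    C = 1 ∨ C = ClassGroup.mk0 ⟨span {(7 : 𝓞 K), thetaInt hθ - 5}, P7_mem_nonZeroDivisors_twentyone hθ⟩ ∨
      C = ClassGroup.mk0 ⟨span {(13 : 𝓞 K), thetaInt hθ - 9}, P13_mem_nonZeroDivisors_twentyone hθ⟩ := by
  classical
  set c5 : ClassGroup (𝓞 K) :=
    ClassGroup.mk0 ⟨span {(7 : 𝓞 K), thetaInt hθ - 5}, P7_mem_nonZeroDivisors_twentyone hθ⟩ with hc5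
  have rel := thetaInt_rel_twentyone hθ
  set t := thetaInt hθ with ht
  have hne : ∀ (x y : 𝓞 K) (n : ℕ), x * y = n → n ≠ 0 → x ≠ 0 := by
    rintro x y n hxy hn rfl
    rw [zero_mul] at hxy
    exact hn (by exact_mod_cast hxy.symm)
  have hne1 : t - 19 ≠ 0 :=
    hne _ (t ^ 2 - 2 * t - 18) 343 (by push_cast; linear_combination (1 : 𝓞 K) * rel)
      (by norm_num)
  have hne2 : 3 * t - 1 ≠ 0 :=
    hne _ (-9 * t ^ 2 + 186 * t - 118) 91 (by push_cast; linear_combination (-27 : 𝓞 K) * rel)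
      (by norm_num)
  have hne3 : 2 * t - 3 ≠ 0 :=
    hne _ (4 * t ^ 2 - 78 * t - 37) 119 (by push_cast; linear_combination (8 : 𝓞 K) * rel)
      (by norm_num)
  have hne4 : t + 2 ≠ 0 :=
    hne _ (t ^ 2 - 23 * t + 66) 133 (by push_cast; linear_combination (1 : 𝓞 K) * rel)
      (by norm_num)
  have hne5 : 5 * t - 4 ≠ 0 :=
    hne _ (-25 * t ^ 2 + 505 * t - 96) 259 (by push_cast; linear_combination (-125 : 𝓞 K) * rel)
      (by norm_num)
  have hne6 : t + 4 ≠ 0 :=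
    hne _ (t ^ 2 - 25 * t + 120) 481 (by push_cast; linear_combination (1 : 𝓞 K) * rel)
      (by norm_num)
  have hne7 : 2 * t - 5 ≠ 0 :=
    hne _ (4 * t ^ 2 - 74 * t - 105) 533 (by push_cast; linear_combination (8 : 𝓞 K) * rel)
      (by norm_num)
  have hne8 : t - 5 ≠ 0 :=
    hne _ (t ^ 2 - 16 * t - 60) 301 (by push_cast; linear_combination (1 : 𝓞 K) * rel)
      (by norm_num)
  have hne9 : 5 * t + 1 ≠ 0 :=
    hne _ (25 * t ^ 2 - 530 * t + 606) 731 (by push_cast; linear_combination (125 : 𝓞 K) * rel)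
      (by norm_num)
  have hne10 : t - 10 ≠ 0 :=
    hne _ (t ^ 2 - 11 * t - 90) 901 (by push_cast; linear_combination (1 : 𝓞 K) * rel)
      (by norm_num)
  have hne11 : t ^ 2 - 2 * t + 2 ≠ 0 :=
    hne _ (-20 * t ^ 2 + 383 * t + 343) 689 (by push_cast; linear_combination (-20 * t + 3) * rel)
      (by norm_num)
  have hne12 : 5 * t - 6 ≠ 0 :=
    hne _ (25 * t ^ 2 - 495 * t - 94) 689 (by push_cast; linear_combination (125 : 𝓞 K) * rel)
      (by norm_num)
  have hne13 : t - 9 ≠ 0 :=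
    hne _ (t ^ 2 - 12 * t - 88) 793 (by push_cast; linear_combination (1 : 𝓞 K) * rel)
      (by norm_num)
  have hne14 : 4 * t + 1 ≠ 0 :=
    hne _ (16 * t ^ 2 - 340 * t + 405) 469 (by push_cast; linear_combination (64 : 𝓞 K) * rel)
      (by norm_num)
  have hne15 : 2 * t ^ 2 - 2 * t - 1 ≠ 0 :=
    hne _ (2 * t ^ 2 + 2 * t - 839) 923 (by push_cast; linear_combination (4 * t + 84) * rel)
      (by norm_num)
  have hne16 : t ^ 2 - 4 * t + 2 ≠ 0 :=
    hne _ (50 * t ^ 2 - 1017 * t + 339) 511 (by push_cast; linear_combination (50 * t - 167) * rel)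
      (by norm_num)
  have hne17 : 2 * t ^ 2 - 1 ≠ 0 :=
    hne _ (-82 * t ^ 2 + 1676 * t - 715) 623 (by push_cast; linear_combination (-164 * t - 92) * rel)
      (by norm_num)
  have hne18 : 2 * t ^ 2 + t - 2 ≠ 0 :=
    hne _ (-127 * t ^ 2 + 2577 * t - 732) 1157 (by push_cast; linear_combination (-254 * t - 307) * rel)
      (by norm_num)
  let H : Subgroup (ClassGroup (𝓞 K)) := Subgroup.zpowers c5
  have hc5H : c5 ∈ H := Subgroup.mem_zpowers c5
  have hinv : ∀ (P Q : Ideal (𝓞 K)) (hP0 : P ∈ (Ideal (𝓞 K))⁰) (hQ0 : Q ∈ (Ideal (𝓞 K))⁰) (x : 𝓞 K),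
      x ≠ 0 → P * Q = span {x} → ClassGroup.mk0 ⟨P, hP0⟩ = (ClassGroup.mk0 ⟨Q, hQ0⟩)⁻¹ := by
    intro P Q hP0 hQ0 x hx hPQ
    exact ClassGroup.mk0_eq_mk0_inv_iff.mpr ⟨x, hx, by simpa using hPQ⟩
  have hprinc : ∀ (P : Ideal (𝓞 K)) (hP0 : P ∈ (Ideal (𝓞 K))⁰) (x : 𝓞 K), P = span {x} →
      ClassGroup.mk0 ⟨P, hP0⟩ ∈ H := by
    intro P hP0 x hPx
    have : ClassGroup.mk0 ⟨P, hP0⟩ = 1 :=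
      (ClassGroup.mk0_eq_one_iff hP0).mpr ⟨⟨x, by rw [hPx, submodule_span_eq]⟩⟩
    rw [this]
    exact H.one_mem
  have hnz : ∀ (n : ℕ) (hn : n ≠ 0) (x : 𝓞 K), span {(n : 𝓞 K), x} ∈ (Ideal (𝓞 K))⁰ :=
    fun n hn x => span_pair_natCast_mem_nonZeroDivisors (K := K) hn x
  have hP5 : span {(7 : 𝓞 K), t - 5} ∈ (Ideal (𝓞 K))⁰ := P7_mem_nonZeroDivisors_twentyone hθ
  have hP13 : span {(13 : 𝓞 K), t - 9} ∈ (Ideal (𝓞 K))⁰ := P13_mem_nonZeroDivisors_twentyone hθ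
  have hP49 : span {(49 : 𝓞 K), t - 19} ∈ (Ideal (𝓞 K))⁰ := by
    have h := hnz 49 (by norm_num) (t - 19)
    simp only [Nat.cast_ofNat] at h
    exact h
  have hP17 : span {(17 : 𝓞 K), t - 10} ∈ (Ideal (𝓞 K))⁰ := by
    have h := hnz 17 (by norm_num) (t - 10)
    simp only [Nat.cast_ofNat] at h
    exact h
  have hpartner : ∀ (Q : Ideal (𝓞 K)) (hQ0 : Q ∈ (Ideal (𝓞 K))⁰) (x : 𝓞 K), x ≠ 0 →
      span {(7 : 𝓞 K), t - 5} * Q = span {x} → ClassGroup.mk0 ⟨Q, hQ0⟩ ∈ H := by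
    intro Q hQ0 x hx hQ
    rw [hinv Q _ hQ0 hP5 x hx (by rw [mul_comm]; exact hQ)]
    exact H.inv_mem hc5H
  -- `[𝔭₁₃] = [𝔭₁₇] = [𝔭₇]⁻¹`; `[𝔭₇]² = [(49, θ - 19)] = [𝔭₇]⁻¹`, so `[𝔭₇]³ = 1`
  have h13cls : ClassGroup.mk0 ⟨span {(13 : 𝓞 K), t - 9}, hP13⟩ = c5⁻¹ :=
    hinv _ _ hP13 hP5 _ hne2 (by rw [mul_comm]; exact P7_mul_P13_twentyone hθ)
  have h17cls : ClassGroup.mk0 ⟨span {(17 : 𝓞 K), t - 10}, hP17⟩ = c5⁻¹ :=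
    hinv _ _ hP17 hP5 _ hne3 (by rw [mul_comm]; exact P7_mul_P17_twentyone hθ)
  have h49cls : ClassGroup.mk0 ⟨span {(49 : 𝓞 K), t - 19}, hP49⟩ = c5⁻¹ :=
    hinv _ _ hP49 hP5 _ hne1 (by rw [mul_comm]; exact P7_mul_P49_twentyone hθ)
  have hsq : c5 * c5 = c5⁻¹ := by
    rw [← h49cls, hc5, ← map_mul]
    congr 1
    exact Subtype.ext (by simpa using P7_mul_P7_twentyone hθ)
  have hcube : c5 ^ (3 : ℤ) = 1 := by
    rw [show (3 : ℤ) = 2 + 1 by norm_num, zpow_add, zpow_two, zpow_one, hsq, inv_mul_cancel]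
  -- Minkowski: `⌊M_K⌋ ≤ 95`
  have hd : ((|NumberField.discr K| : ℤ) : ℝ) ≤ (114889 : ℕ) := by
    rw [discr_eq_twentyone hθ h3]
    norm_num
  have hfloor := floor_minkowskiBound_le_cubic h3 hd (s := 339) (U := 95) (by norm_num)
    (by norm_num) (by norm_num)
  have htop : H = ⊤ := by
    refine classGroup_subgroup_eq_top_of_primesOver H hfloor fun p hp hprime P hP0 hP hle => ?_
    have hpU : p ≤ 95 := (Finset.mem_Icc.mp hp).2
    have h1p : 1 ≤ p := (Finset.mem_Icc.mp hp).1
    interval_cases p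
    · exact absurd hprime (by decide)
    · exact hprinc P hP0 _ (eq_span_of_inert_twentyone hθ h3 (by norm_num) hP)
    · exact hprinc P hP0 _ (eq_span_of_inert_twentyone hθ h3 (by norm_num) hP)
    · exact absurd hprime (by decide)
    · exact hprinc P hP0 _ (eq_span_of_inert_twentyone hθ h3 (by norm_num) hP)
    · exact absurd hprime (by decide)
    · -- `p = 7`
      rcases eq_P7_or_eq_Q7_twentyone hθ h3 hP with h | h <;> subst h
      · exact hc5H
      · exact hpartner _ hP0 7 (by norm_num) (P7_mul_Q7_twentyone hθ)
    · exact absurd hprime (by decide)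
    · exact absurd hprime (by decide)
    · exact absurd hprime (by decide)
    · exact hprinc P hP0 _ (eq_span_of_inert_twentyone hθ h3 (by norm_num) hP)
    · exact absurd hprime (by decide)
    · -- `p = 13`
      have h := eq_span_pair_of_unique_root_twentyone hθ h3 (Or.inl ⟨rfl, rfl⟩) hP hle
      simp only [Nat.cast_ofNat, Int.cast_ofNat] at h
      subst h
      exact hpartner _ hP0 _ hne2 (P7_mul_P13_twentyone hθ)
    · exact absurd hprime (by decide)
    · exact absurd hprime (by decide)
    · exact absurd hprime (by decide)
    · -- `p = 17`
      have h := eq_span_pair_of_unique_root_twentyone hθ h3 (Or.inr (Or.inl ⟨rfl, rfl⟩)) hP hle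
      simp only [Nat.cast_ofNat, Int.cast_ofNat] at h
      subst h
      exact hpartner _ hP0 _ hne3 (P7_mul_P17_twentyone hθ)
    · exact absurd hprime (by decide)
    · -- `p = 19`
      have h := eq_span_pair_of_unique_root_twentyone hθ h3 (Or.inr (Or.inr (Or.inl ⟨rfl, rfl⟩))) hP hle
      simp only [Nat.cast_ofNat, Int.cast_ofNat] at h
      subst h
      exact hpartner _ hP0 _ hne4 (P7_mul_P19_twentyone hθ)
    · exact absurd hprime (by decide)
    · exact absurd hprime (by decide)
    · exact absurd hprime (by decide)
    · exact hprinc P hP0 _ (eq_span_of_inert_twentyone hθ h3 (by norm_num) hP)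
    · exact absurd hprime (by decide)
    · exact absurd hprime (by decide)
    · exact absurd hprime (by decide)
    · exact absurd hprime (by decide)
    · exact absurd hprime (by decide)
    · exact hprinc P hP0 _ (eq_span_of_inert_twentyone hθ h3 (by norm_num) hP)
    · exact absurd hprime (by decide)
    · -- `p = 31`
      have h := eq_span_pair_of_unique_root_twentyone hθ h3 (Or.inr (Or.inr (Or.inr (Or.inl ⟨rfl, rfl⟩)))) hP hle
      simp only [Nat.cast_ofNat, Int.cast_ofNat] at h
      subst h
      exact hprinc _ hP0 _ (P31_eq_twentyone hθ)
    · exact absurd hprime (by decide)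
    · exact absurd hprime (by decide)
    · exact absurd hprime (by decide)
    · exact absurd hprime (by decide)
    · exact absurd hprime (by decide)
    · -- `p = 37` (splits)
      rcases eq_P37_twentyone hθ h3 hP with h | h | h <;> subst h
      · exact hprinc _ hP0 _ (P37a_eq_twentyone hθ)
      · exact hpartner _ hP0 _ hne5 (P7_mul_P37b_twentyone hθ)
      · rw [hinv _ _ hP0 hP13 _ hne6 (by rw [mul_comm]; exact P13_mul_P37c_twentyone hθ), h13cls, inv_inv]
        exact hc5H
    · exact absurd hprime (by decide)
    · exact absurd hprime (by decide)
    · exact absurd hprime (by decide)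
    · -- `p = 41`
      have h := eq_span_pair_of_unique_root_twentyone hθ h3 (Or.inr (Or.inr (Or.inr (Or.inr (Or.inl ⟨rfl, rfl⟩))))) hP hle
      simp only [Nat.cast_ofNat, Int.cast_ofNat] at h
      subst h
      rw [hinv _ _ hP0 hP13 _ hne7 (by rw [mul_comm]; exact P13_mul_P41_twentyone hθ), h13cls, inv_inv]
      exact hc5H
    · exact absurd hprime (by decide)
    · -- `p = 43` (splits)
      rcases eq_P43_twentyone hθ h3 hP with h | h | h <;> subst h
      · exact hpartner _ hP0 _ hne8 (P7_mul_P43a_twentyone hθ)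
      · rw [hinv _ _ hP0 hP17 _ hne9 (by rw [mul_comm]; exact P17_mul_P43b_twentyone hθ), h17cls, inv_inv]
        exact hc5H
      · exact hprinc _ hP0 _ (P43c_eq_twentyone hθ)
    · exact absurd hprime (by decide)
    · exact absurd hprime (by decide)
    · exact absurd hprime (by decide)
    · exact hprinc P hP0 _ (eq_span_of_inert_twentyone hθ h3 (by norm_num) hP)
    · exact absurd hprime (by decide)
    · exact absurd hprime (by decide)
    · exact absurd hprime (by decide)
    · exact absurd hprime (by decide)
    · exact absurd hprime (by decide)
    · -- `p = 53` (splits)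
      rcases eq_P53_twentyone hθ h3 hP with h | h | h <;> subst h
      · rw [hinv _ _ hP0 hP17 _ hne10 (by rw [mul_comm]; exact P17_mul_P53a_twentyone hθ), h17cls, inv_inv]
        exact hc5H
      · rw [hinv _ _ hP0 hP13 _ hne11 (by rw [mul_comm]; exact P13_mul_P53b_twentyone hθ), h13cls, inv_inv]
        exact hc5H
      · rw [hinv _ _ hP0 hP13 _ hne12 (by rw [mul_comm]; exact P13_mul_P53c_twentyone hθ), h13cls, inv_inv]
        exact hc5H
    · exact absurd hprime (by decide)
    · exact absurd hprime (by decide)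
    · exact absurd hprime (by decide)
    · exact absurd hprime (by decide)
    · exact absurd hprime (by decide)
    · exact hprinc P hP0 _ (eq_span_of_inert_twentyone hθ h3 (by norm_num) hP)
    · exact absurd hprime (by decide)
    · -- `p = 61`
      have h := eq_span_pair_of_unique_root_twentyone hθ h3 (Or.inr (Or.inr (Or.inr (Or.inr (Or.inr (Or.inl ⟨rfl, rfl⟩)))))) hP hle
      simp only [Nat.cast_ofNat, Int.cast_ofNat] at h
      subst h
      rw [hinv _ _ hP0 hP13 _ hne13 (by rw [mul_comm]; exact P13_mul_P61_twentyone hθ), h13cls, inv_inv]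
      exact hc5H
    · exact absurd hprime (by decide)
    · exact absurd hprime (by decide)
    · exact absurd hprime (by decide)
    · exact absurd hprime (by decide)
    · exact absurd hprime (by decide)
    · -- `p = 67`
      have h := eq_span_pair_of_unique_root_twentyone hθ h3 (Or.inr (Or.inr (Or.inr (Or.inr (Or.inr (Or.inr (Or.inl ⟨rfl, rfl⟩))))))) hP hle
      simp only [Nat.cast_ofNat, Int.cast_ofNat] at h
      subst h
      exact hpartner _ hP0 _ hne14 (P7_mul_P67_twentyone hθ)
    · exact absurd hprime (by decide)
    · exact absurd hprime (by decide)
    · exact absurd hprime (by decide)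
    · -- `p = 71`
      have h := eq_span_pair_of_unique_root_twentyone hθ h3 (Or.inr (Or.inr (Or.inr (Or.inr (Or.inr (Or.inr (Or.inr (Or.inl ⟨rfl, rfl⟩)))))))) hP hle
      simp only [Nat.cast_ofNat, Int.cast_ofNat] at h
      subst h
      rw [hinv _ _ hP0 hP13 _ hne15 (by rw [mul_comm]; exact P13_mul_P71_twentyone hθ), h13cls, inv_inv]
      exact hc5H
    · exact absurd hprime (by decide)
    · -- `p = 73`
      have h := eq_span_pair_of_unique_root_twentyone hθ h3 (Or.inr (Or.inr (Or.inr (Or.inr (Or.inr (Or.inr (Or.inr (Or.inr (⟨rfl, rfl⟩))))))))) hP hle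
      simp only [Nat.cast_ofNat, Int.cast_ofNat] at h
      subst h
      exact hpartner _ hP0 _ hne16 (P7_mul_P73_twentyone hθ)
    · exact absurd hprime (by decide)
    · exact absurd hprime (by decide)
    · exact absurd hprime (by decide)
    · exact absurd hprime (by decide)
    · exact absurd hprime (by decide)
    · exact hprinc P hP0 _ (eq_span_of_inert_twentyone hθ h3 (by norm_num) hP)
    · exact absurd hprime (by decide)
    · exact absurd hprime (by decide)
    · exact absurd hprime (by decide)
    · exact hprinc P hP0 _ (eq_span_of_inert_twentyone hθ h3 (by norm_num) hP)
    · exact absurd hprime (by decide)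
    · exact absurd hprime (by decide)
    · exact absurd hprime (by decide)
    · exact absurd hprime (by decide)
    · exact absurd hprime (by decide)
    · -- `p = 89` (splits)
      rcases eq_P89_twentyone hθ h3 hP with h | h | h <;> subst h
      · exact hpartner _ hP0 _ hne17 (P7_mul_P89a_twentyone hθ)
      · exact hprinc _ hP0 _ (P89b_eq_twentyone hθ)
      · rw [hinv _ _ hP0 hP13 _ hne18 (by rw [mul_comm]; exact P13_mul_P89c_twentyone hθ), h13cls, inv_inv]
        exact hc5H
    · exact absurd hprime (by decide)
    · exact absurd hprime (by decide)
    · exact absurd hprime (by decide)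
    · exact absurd hprime (by decide)
    · exact absurd hprime (by decide)
    · exact absurd hprime (by decide)
  have hC : C ∈ H := by rw [htop]; exact Subgroup.mem_top C
  obtain ⟨k, rfl⟩ := Subgroup.mem_zpowers_iff.mp hC
  obtain ⟨q, r, hr, rfl⟩ : ∃ q r : ℤ, (r = 0 ∨ r = 1 ∨ r = 2) ∧ k = 3 * q + r :=
    ⟨k / 3, k % 3, by omega, by omega⟩
  rw [zpow_add, zpow_mul, hcube, one_zpow, one_mul]
  rcases hr with rfl | rfl | rfl
  · left
    rw [zpow_zero]
  · right; left
    rw [zpow_one]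
  · right; right
    rw [zpow_two, hsq, ← h13cls]


end Field


/-! ### The ideal classes of `ℤ[X]/(f₂₁)` and Gompf's conjecture for the traces `21` and `-16` -/

section Matrices

/-- **The ideal classes of `ℤ[Θ₂₁] = ℤ[X]/(f₂₁)`**: every non-zero ideal is in the class of
`⟨Θ - 1, 1⟩`, `⟨Θ - 5, 7⟩` or `⟨Θ - 9, 13⟩` (the representatives `(1, 1, 21)`, `(5, 7, 21)`,
`(9, 13, 21)` cover `C(ℤ[Θ₂₁])` — Kim–Yamada, Remark 1.2). [cite: KimYamada2023, §6.1 (proof of Thm. B)] -/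
theorem ideal_class_adjoinRoot_twentyone (J : Ideal (AdjoinRoot (csPoly 21))) (hJ : J ≠ ⊥) :
    ∃ x y : AdjoinRoot (csPoly 21), x ≠ 0 ∧ y ≠ 0 ∧
      (span {x} * J = span {y} * csIdeal 1 1 21 ∨ span {x} * J = span {y} * csIdeal 5 7 21 ∨
        span {x} * J = span {y} * csIdeal 9 13 21) := by
  classical
  set θ' := AdjoinRoot.root (csPolyQ 21) with hθ'
  have hθ : aeval θ' (csPoly 21) = 0 := aeval_root_csPoly 21
  have h3 : finrank ℚ (CSField 21) = 3 := finrank_CSField 21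
  obtain ⟨e, he⟩ := exists_ringEquiv_adjoinRoot_of_sq hθ h3 csDisc_twentyone_sq
  set I : Ideal (𝓞 (CSField 21)) := J.map e with hI
  have hIJ : I.map (e.symm : 𝓞 (CSField 21) →+* AdjoinRoot (csPoly 21)) = J := by
    rw [hI]
    exact Ideal.map_of_equiv e (I := J)
  have hI0 : I ≠ ⊥ := by
    intro h0
    apply hJ
    rw [← hIJ, h0, Ideal.map_bot]
  have hImem : I ∈ (Ideal (𝓞 (CSField 21)))⁰ := mem_nonZeroDivisors_iff_ne_zero.mpr hI0
  have hsymm : ∀ x, (e.symm : 𝓞 (CSField 21) →+* AdjoinRoot (csPoly 21)) (e x) = x :=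
    fun x => e.symm_apply_apply x
  have hP5 : (span {(7 : 𝓞 (CSField 21)), thetaInt hθ - 5}).map
      (e.symm : 𝓞 (CSField 21) →+* AdjoinRoot (csPoly 21)) = csIdeal 5 7 21 := by
    rw [Ideal.map_span, Set.image_insert_eq, Set.image_singleton, map_sub, ← he, hsymm, map_ofNat,
      map_ofNat, csIdeal, Set.pair_comm]
    simp
  have hP7 : (span {(13 : 𝓞 (CSField 21)), thetaInt hθ - 9}).map
      (e.symm : 𝓞 (CSField 21) →+* AdjoinRoot (csPoly 21)) = csIdeal 9 13 21 := by
    rw [Ideal.map_span, Set.image_insert_eq, Set.image_singleton, map_sub, ← he, hsymm, map_ofNat,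
      map_ofNat, csIdeal, Set.pair_comm]
    simp
  have hcase : ∀ (P : Ideal (𝓞 (CSField 21))) (hP0 : P ∈ (Ideal (𝓞 (CSField 21)))⁰)
      (Q : Ideal (AdjoinRoot (csPoly 21))),
      P.map (e.symm : 𝓞 (CSField 21) →+* AdjoinRoot (csPoly 21)) = Q →
      ClassGroup.mk0 ⟨I, hImem⟩ = ClassGroup.mk0 ⟨P, hP0⟩ →
        ∃ x y : AdjoinRoot (csPoly 21), x ≠ 0 ∧ y ≠ 0 ∧ span {x} * J = span {y} * Q := by
    intro P hP0 Q hPQ hcls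
    obtain ⟨x, y, hx, hy, hxy⟩ := ClassGroup.mk0_eq_mk0_iff.mp hcls
    refine ⟨(e.symm : 𝓞 (CSField 21) →+* AdjoinRoot (csPoly 21)) x,
      (e.symm : 𝓞 (CSField 21) →+* AdjoinRoot (csPoly 21)) y,
      (map_ne_zero_iff _ e.symm.injective).mpr hx, (map_ne_zero_iff _ e.symm.injective).mpr hy, ?_⟩
    have h := congrArg (Ideal.map (e.symm : 𝓞 (CSField 21) →+* AdjoinRoot (csPoly 21))) hxy
    simp only [Ideal.map_mul, Ideal.map_span, Set.image_singleton] at h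
    rw [hIJ, hPQ] at h
    exact h
  rcases classGroup_mem_triple_twentyone hθ h3 (ClassGroup.mk0 ⟨I, hImem⟩) with h1 | h5 | h7
  · obtain ⟨z, hz⟩ := ((ClassGroup.mk0_eq_one_iff hImem).mp h1).principal
    have hz' : I = span {z} := by rw [hz, submodule_span_eq]
    have hz0 : z ≠ 0 := by
      rintro rfl
      apply hI0
      rw [hz', Ideal.span_singleton_eq_bot]
    refine ⟨1, (e.symm : 𝓞 (CSField 21) →+* AdjoinRoot (csPoly 21)) z, one_ne_zero,
      (map_ne_zero_iff _ e.symm.injective).mpr hz0, Or.inl ?_⟩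
    rw [Ideal.span_singleton_one, Ideal.top_mul, csIdeal_one_one, Ideal.mul_top, ← hIJ, hz',
      Ideal.map_span, Set.image_singleton]
  · obtain ⟨x, y, hx, hy, h⟩ := hcase _ _ _ hP5 h5
    exact ⟨x, y, hx, hy, Or.inr (Or.inl h)⟩
  · obtain ⟨x, y, hx, hy, h⟩ := hcase _ _ _ hP7 h7
    exact ⟨x, y, hx, hy, Or.inr (Or.inr h)⟩

/-- `7 ∣ f₂₁(5) = -301`: `(5, 7, 21) ∈ 𝒞𝒮`. [cite: KimYamada2023, Remark 1.2] -/
theorem five_dvd_eval_csPoly_twentyone_four : (7 : ℤ) ∣ (csPoly 21).eval 5 := by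
  rw [eval_csPoly]; norm_num

/-- `13 ∣ f₂₁(9) = -793`: `(9, 13, 21) ∈ 𝒞𝒮`. [cite: KimYamada2023, Remark 1.2] -/
theorem seven_dvd_eval_csPoly_twentyone_six : (13 : ℤ) ∣ (csPoly 21).eval 9 := by
  rw [eval_csPoly]; norm_num

/-- **Every Cappell–Shaneson matrix of trace `21` is similar to `X_{1,1,21} = A₁₉`, `X_{5,7,21}` or
`X_{9,13,21}`** (Prop. 2.14; Kim–Yamada, Remark 1.2). [cite: KimYamada2023, §6.1 (proof of Thm. B) and Prop. 2.14] -/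
theorem isConj_standardCSMatrix_of_trace_eq_twentyone (A : SL(3, ℤ))
    (hdet : ((A : Matrix (Fin 3) (Fin 3) ℤ) - 1).det = 1)
    (htr : Matrix.trace (A : Matrix (Fin 3) (Fin 3) ℤ) = 21) :
    IsConj A (standardCSMatrix 1 1 21 (one_dvd _)) ∨
      IsConj A (standardCSMatrix 5 7 21 five_dvd_eval_csPoly_twentyone_four) ∨
      IsConj A (standardCSMatrix 9 13 21 seven_dvd_eval_csPoly_twentyone_six) := by
  have hcover : ∀ J : Ideal (AdjoinRoot (csPoly 21)), J ≠ ⊥ →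
      ∃ (c d : ℤ) (_ : d ∣ (csPoly 21).eval c) (x y : AdjoinRoot (csPoly 21)),
        x ≠ 0 ∧ y ≠ 0 ∧ Ideal.span {x} * J = Ideal.span {y} * csIdeal c d 21 ∧
          ((c = 1 ∧ d = 1) ∨ (c = 5 ∧ d = 7) ∨ (c = 9 ∧ d = 13)) := by
    intro J hJ
    obtain ⟨x, y, hx, hy, hxy⟩ := ideal_class_adjoinRoot_twentyone J hJ
    rcases hxy with h1 | h5 | h7
    · exact ⟨1, 1, one_dvd _, x, y, hx, hy, h1, Or.inl ⟨rfl, rfl⟩⟩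
    · exact ⟨5, 7, five_dvd_eval_csPoly_twentyone_four, x, y, hx, hy, h5, Or.inr (Or.inl ⟨rfl, rfl⟩)⟩
    · exact ⟨9, 13, seven_dvd_eval_csPoly_twentyone_six, x, y, hx, hy, h7, Or.inr (Or.inr ⟨rfl, rfl⟩)⟩
  obtain ⟨c, d, h, hconj, hcd⟩ := exists_isConj_standardCSMatrix_of_cover _ hcover A hdet htr
  rcases hcd with ⟨rfl, rfl⟩ | ⟨rfl, rfl⟩ | ⟨rfl, rfl⟩
  · exact Or.inl hconj
  · exact Or.inr (Or.inl hconj)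
  · exact Or.inr (Or.inr hconj)

/-- **Kim–Yamada 2023, Theorem B for the trace `21`, PROVED**: the classes `(5, 7, 21)` and
`(9, 13, 21)` move by Gompf moves to the traces `7 = 21 - 2·7` and `8 = 21 - 13`, where Gompf's
conjecture holds (class number one). [cite: KimYamada2023, Thm. B and §6.1] -/
theorem gompfConjectureForTrace_twentyone : GompfConjectureForTrace 21 := by
  intro A hdet htr
  rcases isConj_standardCSMatrix_of_trace_eq_twentyone A hdet htr with h1 | h5 | h7
  · exact (GompfEquiv.of_isConj h1).trans (gompfEquiv_standardCSMatrix_one_one 19 (one_dvd _))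
  · exact (GompfEquiv.of_isConj h5).trans
      (gompfEquiv_standardCSMatrix_akbulutKirbyMatrix_of_modEq
        (gompfConjectureForTrace_of_mem_Icc (by norm_num)) five_dvd_eval_csPoly_twentyone_four
        (show (21 : ℤ) ≡ 7 [ZMOD 7] by decide))
  · exact (GompfEquiv.of_isConj h7).trans
      (gompfEquiv_standardCSMatrix_akbulutKirbyMatrix_of_modEq
        (gompfConjectureForTrace_of_mem_Icc (by norm_num)) seven_dvd_eval_csPoly_twentyone_six
        (show (21 : ℤ) ≡ 8 [ZMOD 13] by decide))

/-- **Theorem B for the trace `-16`** (`= 5 - 21`), by Theorem A. [cite: KimYamada2023, Thm. A and Thm. B] -/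
theorem gompfConjectureForTrace_neg_sixteen : GompfConjectureForTrace (-16) := by
  have h := gompfConjectureForTrace_of_five_sub gompfConjectureForTrace_twentyone
  norm_num at h
  exact h

end Matrices


end Literature.Topology.FourManifolds

end
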